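import Summits.HubbardSuperconductivity.HubbardSuperconductivity.Theorems.AnisotropyChordTransferLevelOne

/-!
# Route `AnisotropyChord` / H0 rotor rung, route (1): **COROLLARY L1′ — flip-odd states at half filling lie strictly above `E(±1)`**
# (even torus, `|Δ| < 1`; theory seat `hubbard-h0-rotor-theory-1` g12, THEOREM-L1.md «L1′», PartF.lean `FlipOddAboveSectorOne`)

For the easy-plane XXZ ferromagnet `H(Δ) = xxzHamiltonian 1 (torusGraph 2 L) (−1) Δ` on `(ℤ/L)²`, `L` even, `|Δ| < 1`: every real unit amplitude `φ` of
the sector `Sᶻ_tot = 0` that is ODD under the global spin flip has energy `⟨φ, Hφ⟩ > E(1)` — the flip-odd gap at half filling exceeds the first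
tower spacing `E(1) − E(0)` (`flipOddAboveSectorOne_holds`; the theory seat's Prop `FlipOddAboveSectorOne` and its `flipCfg` are ported VERBATIM).
Proof: in the rotated frame (`…TransferRotatedPackage`) the global flip is the parity operator, so `Uφ` lies in the ODD parity block; the odd-block
minimum `E_o` satisfies `E(1) ≤ E_o` (`sectorE_one_le_oddBlockMin`, as in `…TransferLevelOne`) and `E_o ≤ ⟨Uφ, H'Uφ⟩ = ⟨φ, Hφ⟩`, with equality only
if `Uφ` is an odd-block ground vector, i.e. `∝ P_o`, a `(Sʸ_tot)² = 1` vector (`oddBlock_perron_Ysq`) — impossible since `Sʸ_tot(Uφ) = 0`.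
[variant/corollary of Mattis 1979 PRL 42:1503; cf. Nishimori 1981, Lieb–Mattis 1962, Tasaki 2018 p.7, ALSSY App. A = tree p662305].
Prover seat `hubbard-h0-rotor-p1` g14.
-/

set_option linter.dupNamespace false
set_option autoImplicit false

noncomputable section

open Finset Matrix
open scoped ComplexOrder
open Literature.MathematicalPhysics.QuantumLattice Literature.MathematicalPhysics.QuantumLattice.SpinOperators
open Literature.Probability.LatticeModels
open Summit.HubbardSuperconductivity.HubbardSuperconductivity.Theorems.AnisotropyChord.InsertionEntropy
open Summit.HubbardSuperconductivity.HubbardSuperconductivity.Theorems.AnisotropyChord.Tower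
open Summit.AtomisticToContinuum.BoseEinsteinCondensation.Theorems.BECStronglyRayleighSectorPerron (torusGraph_connected)

namespace Summit.HubbardSuperconductivity.HubbardSuperconductivity.Theorems.AnisotropyChord.Transfer

variable (L : ℕ) [NeZero L]

/-- configuration with every spin flipped (`Fin 2`-valued: `0 ↔ 1`) — VERBATIM port of the theory seat's `flipCfg` (PartF.lean); on the sector
`M = 0` this is the particle–hole map. [folklore] -/
def flipCfg (σ : TensorIndex (TorusSite 2 L) 2) : TensorIndex (TorusSite 2 L) 2 := fun v => (σ v).rev

/-- **COROLLARY L1′ (theory seat g12, PartF.lean VERBATIM): flip-odd states at half filling lie strictly above `E(±1)`.**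
[conjecture: theory seat hubbard-h0-rotor-theory-1, cycle 12, THEOREM-L1.md — COROLLARY L1′, PROVED on paper; Lean proof `flipOddAboveSectorOne_holds` below] -/
def FlipOddAboveSectorOne (Δ : ℝ) : Prop :=
  ∀ (L : ℕ) [NeZero L], Even L → |Δ| < 1 →
    ∀ φ : TensorIndex (TorusSite 2 L) 2 → ℝ,
      cplx L φ ∈ spinZSector (Λ := TorusSite 2 L) 1 0 →
      (∀ σ, φ (flipCfg L σ) = -φ σ) → ∑ σ, φ σ ^ 2 = 1 →
        sectorE L Δ 1 < energyQ L Δ φ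

omit [NeZero L] in
/-- `flipCfg` is the tree's `flipAll`. [folklore] -/
theorem flipCfg_eq_flipAll (σ : TensorIndex (TorusSite 2 L) 2) : flipCfg L σ = flipAll σ := by
  funext v
  show (σ v).rev = 1 - σ v
  rcases Fin.exists_fin_two.mp ⟨σ v, rfl⟩ with h | h <;> rw [h] <;> rfl

/-- a parity-preserving operator maps vectors supported in a class into the same class. [folklore] -/
theorem mulVec_support_of_parityPreserving {Λ : Type*} [Fintype Λ] [DecidableEq Λ] (H : Op Λ 2)
    (hpar : ∀ σ τ : TensorIndex Λ 2, (∑ z, (σ z : ℕ)) % 2 ≠ (∑ z, (τ z : ℕ)) % 2 → H σ τ = 0) (r : ℕ)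
    {w : TensorIndex Λ 2 → ℂ} (hw : ∀ σ, (∑ z, (σ z : ℕ)) % 2 ≠ r → w σ = 0) :
    ∀ σ : TensorIndex Λ 2, (∑ z, (σ z : ℕ)) % 2 ≠ r → (H *ᵥ w) σ = 0 := by
  intro σ hσ
  rw [Matrix.mulVec, dotProduct]
  refine Finset.sum_eq_zero fun τ _ => ?_
  by_cases hτ : (∑ z, (τ z : ℕ)) % 2 = r
  · rw [hpar σ τ (by rw [hτ]; exact hσ), zero_mul]
  · rw [hw τ hτ, mul_zero]

/-- **`E(1) ≤ E_o`**: the first sector energy is at most the odd-block minimum of the rotated Hamiltonian `H'(1,Δ,1)` (the odd-block minimum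
is attained by an `Sʸ_tot = ±1` eigenvector, i.e. in the original sectors `∓1`, and `E(1) = E(−1)`). [folklore] -/
theorem sectorE_one_le_oddBlockMin (hL : Even L) {Δ : ℝ} (hΔ : |Δ| < 1) :
    sectorE L Δ 1 ≤ (xyzBondHamiltonian₃ (d := 2) L 1 1 Δ 1).minEnergyOn (paritySubmodule (Λ := TorusSite 2 L) 1) := by
  obtain ⟨a₀, ha₀⟩ := exists_perron_zero_of_even Δ hL
  obtain ⟨U, hU, hU', hUH, hSz, hSy, hFlip, hEt, hP0, hPsupp, hHP, hYP, hYYX⟩ := exists_rotated_package L hL hΔ ha₀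
  have hΔ1 : -Δ ≤ 1 := by have := (abs_lt.1 hΔ).1; linarith
  have hΔ2 : Δ ≤ 1 := (abs_lt.1 hΔ).2.le
  obtain ⟨hreal, hsymm, hoff⟩ := xyzBondHamiltonian₃_entries (d := 2) L 1 1 Δ 1 hΔ1 hΔ2
  have hHt : (xyzBondHamiltonian₃ (d := 2) L 1 1 Δ 1).IsHermitian := xyzBondHamiltonian₃_isHermitian (d := 2) L 1 1 Δ 1
  have hpar : ∀ σ τ : TensorIndex (TorusSite 2 L) 2, (∑ z, (σ z : ℕ)) % 2 ≠ (∑ z, (τ z : ℕ)) % 2 →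
      xyzBondHamiltonian₃ (d := 2) L 1 1 Δ 1 σ τ = 0 := fun σ τ h => xyzBondHamiltonian₃_one_apply_of_parity_ne (d := 2) L 1 Δ 1 h
  have hflip : ∀ (x y : TorusSite 2 L) (σ : TensorIndex (TorusSite 2 L) 2), (torusGraph 2 L).Adj x y →
      xyzBondHamiltonian₃ (d := 2) L 1 1 Δ 1 σ (flipAt x (flipAt y σ)) ≠ 0 := by
    intro x y σ hxy
    rw [xyzBondHamiltonian₃_one_apply_doubleFlip (d := 2) L 1 Δ 1 hxy σ, neg_ne_zero, Complex.ofReal_ne_zero]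
    have h1 := (abs_lt.1 hΔ).1
    have h2 := (abs_lt.1 hΔ).2
    split_ifs <;> · intro h; linarith
  have hcomm := (HardCoreBoson.commute_xxzHamiltonian_totalSpin_two 1 (torusGraph 2 L) (-1) Δ).eq
  have hHY : xyzBondHamiltonian₃ (d := 2) L 1 1 Δ 1 * (totalSpin 1 1 : Op (TorusSite 2 L) 2) =
      (totalSpin 1 1 : Op (TorusSite 2 L) 2) * xyzBondHamiltonian₃ (d := 2) L 1 1 Δ 1 := by
    have h2 : (totalSpin 1 1 : Op (TorusSite 2 L) 2) = -(U * (totalSpin 1 2 : Op (TorusSite 2 L) 2) * Uᴴ) := by rw [hSz, neg_neg]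
    rw [← hUH, h2, mul_neg, neg_mul, conj_mul_conj hU' _ _, conj_mul_conj hU' _ _, hcomm]
  have hYh : (totalSpin 1 1 : Op (TorusSite 2 L) 2)ᴴ = totalSpin 1 1 := (totalSpin_isHermitian 1 1).eq
  have hYpar : ∀ σ τ : TensorIndex (TorusSite 2 L) 2, (∑ z, (σ z : ℕ)) % 2 = (∑ z, (τ z : ℕ)) % 2 →
      (totalSpin 1 1 : Op (TorusSite 2 L) 2) σ τ = 0 := fun σ τ h => totalSpin_one_one_apply_of_parity_eq h
  have hX : ∀ (v : TensorIndex (TorusSite 2 L) 2 → ℂ) (τ : TensorIndex (TorusSite 2 L) 2),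
      ((totalSpin 1 0 : Op (TorusSite 2 L) 2) *ᵥ v) τ = (∑ x, v (flipAt x τ)) / 2 := totalSpin_one_zero_mulVec
  have hG := torusGraph_connected 2 L
  set H : Op (TorusSite 2 L) 2 := xxzHamiltonian 1 (torusGraph 2 L) (-1) Δ with hHdef
  have hH : H.IsHermitian := xxzHamiltonian_isHermitian 1 (torusGraph 2 L) (-1) Δ
  have hHU : H = Uᴴ * xyzBondHamiltonian₃ (d := 2) L 1 1 Δ 1 * U := by
    rw [← hUH]
    calc H = (Uᴴ * U) * H * (Uᴴ * U) := by rw [hU', Matrix.one_mul, Matrix.mul_one]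
      _ = Uᴴ * (U * H * Uᴴ) * U := by simp only [Matrix.mul_assoc]
  have hSzU : (totalSpin 1 2 : Op (TorusSite 2 L) 2) = -(Uᴴ * (totalSpin 1 1 : Op (TorusSite 2 L) 2) * U) := by
    calc (totalSpin 1 2 : Op (TorusSite 2 L) 2) = (Uᴴ * U) * totalSpin 1 2 * (Uᴴ * U) := by
          rw [hU', Matrix.one_mul, Matrix.mul_one]
      _ = Uᴴ * (U * totalSpin 1 2 * Uᴴ) * U := by simp only [Matrix.mul_assoc]
      _ = -(Uᴴ * totalSpin 1 1 * U) := by rw [hSz, Matrix.mul_neg, Matrix.neg_mul, Matrix.mul_assoc]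
  obtain ⟨p, hp0, hHp, hYp⟩ := exists_oddGround_Y_eq (torusGraph 2 L) hG (fun _ => 0) _ _ _ hHt hreal hsymm hoff hpar hflip hHY hYh
    hYpar hX hEt hP0 hPsupp hHP hYYX
  set Eo : ℝ := (xyzBondHamiltonian₃ (d := 2) L 1 1 Δ 1).minEnergyOn (paritySubmodule (Λ := TorusSite 2 L) 1) with hEo
  have hu0 : Uᴴ *ᵥ p ≠ 0 := mulVec_ne_zero_of_left_inverse (U := Uᴴ) (V := U) hU hp0
  have hHu : H *ᵥ (Uᴴ *ᵥ p) = (Eo : ℂ) • (Uᴴ *ᵥ p) := by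
    rw [hHU, Matrix.mulVec_mulVec, Matrix.mul_assoc, Matrix.mul_assoc, hU, Matrix.mul_one, ← Matrix.mulVec_mulVec, hHp,
      Matrix.mulVec_smul]
  have hsec : ∀ s : ℝ, (totalSpin 1 2 : Op (TorusSite 2 L) 2) *ᵥ (Uᴴ *ᵥ p) = (s : ℂ) • (Uᴴ *ᵥ p) → sectorE L Δ s ≤ Eo := by
    intro s hs
    have hmem : Uᴴ *ᵥ p ∈ spinZSector (Λ := TorusSite 2 L) 1 s := by
      rw [spinZSector, Module.End.mem_eigenspace_iff, Matrix.toLin'_apply, hs]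
    have h := minEnergyOn_mul_le_re_rayleigh hH (spinZSector (Λ := TorusSite 2 L) 1 s) hmem
    rw [hHu, dotProduct_smul, smul_eq_mul, Complex.re_ofReal_mul] at h
    exact le_of_mul_le_mul_right h (EigenvalueContinuation.re_star_dotProduct_self_pos hu0)
  have hSzu : (totalSpin 1 2 : Op (TorusSite 2 L) 2) *ᵥ (Uᴴ *ᵥ p) = -(Uᴴ *ᵥ ((totalSpin 1 1 : Op (TorusSite 2 L) 2) *ᵥ p)) := by
    rw [hSzU, Matrix.neg_mulVec, Matrix.mulVec_mulVec, Matrix.mul_assoc, Matrix.mul_assoc, hU, Matrix.mul_one, ← Matrix.mulVec_mulVec]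
  rcases hYp with hYp | hYp
  · rw [sectorE_one_eq_neg_one L hL ha₀]
    refine hsec (-1) ?_
    rw [hSzu, hYp]; push_cast; rw [neg_one_smul]
  · refine hsec 1 ?_
    rw [hSzu, hYp, Matrix.mulVec_neg, neg_neg]; push_cast; rw [one_smul]

/-- **COROLLARY L1′: a flip-odd real unit amplitude of the sector `Sᶻ_tot = 0` has energy `> E(1)`** (even torus, `|Δ| < 1`). [folklore] -/
theorem sectorE_one_lt_energyQ_of_flipOdd (hL : Even L) {Δ : ℝ} (hΔ : |Δ| < 1) {φ : TensorIndex (TorusSite 2 L) 2 → ℝ}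
    (hφ0 : cplx L φ ∈ spinZSector (Λ := TorusSite 2 L) 1 (0 : ℝ)) (hodd : ∀ σ, φ (flipAll σ) = -φ σ) (hunit : ∑ σ, φ σ ^ 2 = 1) :
    sectorE L Δ 1 < energyQ L Δ φ := by
  obtain ⟨k, hk⟩ := hL
  have hm := card_torusSite_two_of_even L hk
  obtain ⟨a₀, ha₀⟩ := exists_perron_zero_of_even Δ ⟨k, hk⟩
  obtain ⟨U, hU, hU', hUH, hSz, hSy, hFlip, hEt, hP0, hPsupp, hHP, hYP, hYYX⟩ := exists_rotated_package L ⟨k, hk⟩ hΔ ha₀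
  have hΔ1 : -Δ ≤ 1 := by have := (abs_lt.1 hΔ).1; linarith
  have hΔ2 : Δ ≤ 1 := (abs_lt.1 hΔ).2.le
  obtain ⟨hreal, hsymm, hoff⟩ := xyzBondHamiltonian₃_entries (d := 2) L 1 1 Δ 1 hΔ1 hΔ2
  have hHt : (xyzBondHamiltonian₃ (d := 2) L 1 1 Δ 1).IsHermitian := xyzBondHamiltonian₃_isHermitian (d := 2) L 1 1 Δ 1
  have hpar : ∀ σ τ : TensorIndex (TorusSite 2 L) 2, (∑ z, (σ z : ℕ)) % 2 ≠ (∑ z, (τ z : ℕ)) % 2 →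
      xyzBondHamiltonian₃ (d := 2) L 1 1 Δ 1 σ τ = 0 := fun σ τ h => xyzBondHamiltonian₃_one_apply_of_parity_ne (d := 2) L 1 Δ 1 h
  have hflip : ∀ (x y : TorusSite 2 L) (σ : TensorIndex (TorusSite 2 L) 2), (torusGraph 2 L).Adj x y →
      xyzBondHamiltonian₃ (d := 2) L 1 1 Δ 1 σ (flipAt x (flipAt y σ)) ≠ 0 := by
    intro x y σ hxy
    rw [xyzBondHamiltonian₃_one_apply_doubleFlip (d := 2) L 1 Δ 1 hxy σ, neg_ne_zero, Complex.ofReal_ne_zero]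
    have h1 := (abs_lt.1 hΔ).1
    have h2 := (abs_lt.1 hΔ).2
    split_ifs <;> · intro h; linarith
  have hcomm := (HardCoreBoson.commute_xxzHamiltonian_totalSpin_two 1 (torusGraph 2 L) (-1) Δ).eq
  have hHY : xyzBondHamiltonian₃ (d := 2) L 1 1 Δ 1 * (totalSpin 1 1 : Op (TorusSite 2 L) 2) =
      (totalSpin 1 1 : Op (TorusSite 2 L) 2) * xyzBondHamiltonian₃ (d := 2) L 1 1 Δ 1 := by
    have h2 : (totalSpin 1 1 : Op (TorusSite 2 L) 2) = -(U * (totalSpin 1 2 : Op (TorusSite 2 L) 2) * Uᴴ) := by rw [hSz, neg_neg]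
    rw [← hUH, h2, mul_neg, neg_mul, conj_mul_conj hU' _ _, conj_mul_conj hU' _ _, hcomm]
  have hYh : (totalSpin 1 1 : Op (TorusSite 2 L) 2)ᴴ = totalSpin 1 1 := (totalSpin_isHermitian 1 1).eq
  have hYpar : ∀ σ τ : TensorIndex (TorusSite 2 L) 2, (∑ z, (σ z : ℕ)) % 2 = (∑ z, (τ z : ℕ)) % 2 →
      (totalSpin 1 1 : Op (TorusSite 2 L) 2) σ τ = 0 := fun σ τ h => totalSpin_one_one_apply_of_parity_eq h
  have hX : ∀ (v : TensorIndex (TorusSite 2 L) 2 → ℂ) (τ : TensorIndex (TorusSite 2 L) 2),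
      ((totalSpin 1 0 : Op (TorusSite 2 L) 2) *ᵥ v) τ = (∑ x, v (flipAt x τ)) / 2 := totalSpin_one_zero_mulVec
  have hG := torusGraph_connected 2 L
  obtain ⟨Po, hPo0, hPosupp, -, hHPo, hYYPo, hEob, hPouniq⟩ := oddBlock_perron_Ysq (torusGraph 2 L) hG (fun _ => 0) _ _ _ hHt hreal
    hsymm hoff hpar hflip hHY hYh hYpar hX hEt hP0 hPsupp hHP hYYX
  set Ht := xyzBondHamiltonian₃ (d := 2) L 1 1 Δ 1 with hHtdef
  set Eo : ℝ := Ht.minEnergyOn (paritySubmodule (Λ := TorusSite 2 L) 1) with hEo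
  -- the rotated amplitude `ψ = U φ`
  set cφ : TensorIndex (TorusSite 2 L) 2 → ℂ := cplx L φ with hcφ
  have hcφflip : (fun σ => cφ (fun z => 1 - σ z)) = -cφ := by
    funext σ
    rw [Pi.neg_apply, hcφ]
    show ((φ (flipAll σ) : ℝ) : ℂ) = -((φ σ : ℝ) : ℂ)
    rw [hodd σ, Complex.ofReal_neg]
  have hSzcφ : (totalSpin 1 2 : Op (TorusSite 2 L) 2) *ᵥ cφ = 0 := by
    rw [LiebMattis.totalSpin_two_mulVec_of_mem 1 hφ0, Complex.ofReal_zero, zero_smul]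
  -- `U φ` is odd-supported
  have hψsupp : ∀ σ : TensorIndex (TorusSite 2 L) 2, (∑ z, (σ z : ℕ)) % 2 ≠ 1 → (U *ᵥ cφ) σ = 0 := by
    intro σ hσ
    have h1 : productOp (fun _ : TorusSite 2 L => -spinHalfPauli 2) *ᵥ (U *ᵥ cφ) = -(U *ᵥ cφ) := by
      have h2 : productOp (fun _ : TorusSite 2 L => -spinHalfPauli 2) * U =
          U * productOp (fun _ : TorusSite 2 L => spinHalfPauli 0) := by
        rw [← hFlip, Matrix.mul_assoc, hU', Matrix.mul_one]
      rw [Matrix.mulVec_mulVec, h2, ← Matrix.mulVec_mulVec, ← Matrix.mulVec_neg, ← hcφflip]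
      congr 1
      funext τ
      rw [flipXOp_mulVec]
    have h3 := congrFun h1 σ
    rw [parityOp_mulVec hm, Pi.neg_apply] at h3
    have hσ0 : (∑ z, (σ z : ℕ)) % 2 = 0 := by have := Nat.mod_lt (∑ z, (σ z : ℕ)) two_pos; omega
    rw [neg_one_pow_eq_pow_mod_two (R := ℂ), hσ0, pow_zero, one_mul] at h3
    have : (2 : ℂ) * (U *ᵥ cφ) σ = 0 := by linear_combination h3
    exact (mul_eq_zero.1 this).resolve_left two_ne_zero
  -- `Sʸ_tot (U φ) = 0`
  have hYψ : (totalSpin 1 1 : Op (TorusSite 2 L) 2) *ᵥ (U *ᵥ cφ) = 0 := by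
    have h2 : (totalSpin 1 1 : Op (TorusSite 2 L) 2) = -(U * (totalSpin 1 2 : Op (TorusSite 2 L) 2) * Uᴴ) := by rw [hSz, neg_neg]
    rw [h2, Matrix.neg_mulVec, conj_mulVec_mulVec hU', hSzcφ, Matrix.mulVec_zero, neg_zero]
  -- Rayleigh quotient and norm in the rotated frame
  have hnorm : star (U *ᵥ cφ) ⬝ᵥ (U *ᵥ cφ) = 1 := by
    have h := star_dotProduct_conjTranspose_mulVec (U := Uᴴ) (by rw [Matrix.conjTranspose_conjTranspose]; exact hU') cφ
    rw [Matrix.conjTranspose_conjTranspose] at h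
    rw [h]
    have : star cφ ⬝ᵥ cφ = ((∑ σ, φ σ ^ 2 : ℝ) : ℂ) := by
      rw [dotProduct]; push_cast
      refine Finset.sum_congr rfl fun σ _ => ?_
      rw [Pi.star_apply, hcφ]; unfold cplx; rw [Complex.star_def, Complex.conj_ofReal]; ring
    rw [this, hunit]; norm_num
  have hray : (star (U *ᵥ cφ) ⬝ᵥ Ht *ᵥ (U *ᵥ cφ)).re = energyQ L Δ φ := by
    rw [← hUH, star_dotProduct_conj_mulVec, Matrix.mulVec_mulVec, hU', Matrix.one_mulVec]
    rfl
  -- `E_o ≤ ⟨φ, Hφ⟩`, strictly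
  have hle : Eo ≤ energyQ L Δ φ := by
    have h := hEob (U *ᵥ cφ) hψsupp
    rw [hnorm, Complex.one_re, mul_one, hray] at h
    exact h
  have hne : Eo ≠ energyQ L Δ φ := by
    intro hEq
    -- then `U φ` minimises on the odd block, hence is an eigenvector there
    have hW : ∀ v ∈ paritySubmodule (Λ := TorusSite 2 L) 1, Ht *ᵥ v ∈ paritySubmodule (Λ := TorusSite 2 L) 1 := by
      intro v hv
      rw [mem_paritySubmodule_iff] at hv ⊢
      exact mulVec_support_of_parityPreserving Ht hpar 1 hv
    have hEW : ∀ v ∈ paritySubmodule (Λ := TorusSite 2 L) 1, Eo * (star v ⬝ᵥ v).re ≤ (star v ⬝ᵥ Ht *ᵥ v).re := by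
      intro v hv
      rw [mem_paritySubmodule_iff] at hv
      exact hEob v hv
    have hmem : U *ᵥ cφ ∈ paritySubmodule (Λ := TorusSite 2 L) 1 := (mem_paritySubmodule_iff 1 _).2 hψsupp
    have heig := EigenvalueContinuation.mulVec_eq_smul_of_forall_le_on hHt.eq (paritySubmodule (Λ := TorusSite 2 L) 1) hW hEW hmem
      (by rw [hnorm, Complex.one_re, mul_one, hray, hEq])
    obtain ⟨c, hc⟩ := hPouniq (U *ᵥ cφ) hψsupp heig
    have h1 : (totalSpin 1 1 : Op (TorusSite 2 L) 2) *ᵥ ((totalSpin 1 1 : Op (TorusSite 2 L) 2) *ᵥ (U *ᵥ cφ)) = U *ᵥ cφ := by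
      conv_rhs => rw [hc]
      rw [hc, Matrix.mulVec_smul, Matrix.mulVec_smul, hYYPo]
    rw [hYψ, Matrix.mulVec_zero] at h1
    have h2 : star (U *ᵥ cφ) ⬝ᵥ (U *ᵥ cφ) = 0 := by rw [← h1, dotProduct_zero]
    rw [hnorm] at h2
    exact one_ne_zero h2
  exact lt_of_le_of_lt (sectorE_one_le_oddBlockMin L ⟨k, hk⟩ hΔ) (lt_of_le_of_ne hle hne)

/-- **COROLLARY L1′ HOLDS**: `FlipOddAboveSectorOne Δ` for every `Δ` (the Prop carries the hypotheses `Even L`, `|Δ| < 1` itself).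
[conjecture: theory seat hubbard-h0-rotor-theory-1, cycle 12, THEOREM-L1.md — COROLLARY L1′; Lean proof here] -/
theorem flipOddAboveSectorOne_holds (Δ : ℝ) : FlipOddAboveSectorOne Δ := by
  intro L _ hL hΔ φ hφ0 hodd hunit
  exact sectorE_one_lt_energyQ_of_flipOdd L hL hΔ hφ0 (fun σ => by rw [← flipCfg_eq_flipAll]; exact hodd σ) hunit

end Summit.HubbardSuperconductivity.HubbardSuperconductivity.Theorems.AnisotropyChord.Transfer
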